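import Mathlib
import HarnessLib
import Literature.Topology.Euclidean.SphereUnicoherence
import Summits.NavierStokesRegularity.NavierStokesRegularity.Theorems.UnthreadedDoorNetFluxDefs
import Summits.NavierStokesRegularity.NavierStokesRegularity.Theorems.UnthreadedDoorNetFluxSphereSard
import Summits.NavierStokesRegularity.NavierStokesRegularity.Theorems.UnthreadedDoorNetFluxLevelChart

/-!
# Route `UnthreadedDoor`, crux `PoloidalLiouville` (stmt-NavierStokesRegularity-1222), WALL W1 — netflux line,
# NF-1a toolkit: the LAST-CROSSING LEMMA and LEVEL CONSTANCY on saddle-free spheres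

Tools for the research stub NF-1a `stub_extremalHeadEMF` (`NetFlux.ExtremalHeadEMF`) of the registered line
`Cruxes/PoloidalLiouville/Lines/netflux_typei_gap.lean` (planner ns-idea-14; toolkit sub-stubs (An3) `stub_lastCrossing` and
(An1) `stub_const_on_preconnected_levelSubset` of `netflux_typei_gap_nf1a_toolkit.lean`).

* **`lastCrossing_le`** (pure one-variable analysis): `Q` continuous on `[a,b]`, locally non-increasing to the right at every
  point of `[a,b)` outside a set `C`, with `Q(C ∩ [a,b])` Lebesgue-null ⇒ `Q b ≤ Q a`.  (Take a value `y ∈ (Q a, Q b)` off the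
  null set; the LAST point `s` of `{Q ≤ y}` has `Q s = y`, lies outside `C`, and `Q ≤ y` just right of `s` contradicts the
  choice of `s`.)  This is the device that defeats the «Cantor staircase» objection: a derivative bound off a null set of
  VALUES controls the increment.  No closedness of `C` is needed.
* **`eq_of_level`** (level constancy): on the sphere `S_r(x₀)`, `r > 0`, with `f, ν` smooth and `h ∈ C¹` off `x₀`,
  `∇h − ν∇f ∥ (x − x₀)` on `S`, and `f|_S` saddle-free (`IsUnimodalSphere`): `f x = f y ⇒ h x = h y` for `x, y ∈ S`.
  Proof: the level set `Z = {f = c}` is connected (`SphereUnicoherence.isPreconnected_levelSet`, unicoherence of `S²`), so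
  `h(Z)` is an interval; it is contained in `h(Crit f|_S)` (null by Sard on the sphere,
  `volume_image_sphCrit_of_parallel_eq_zero`) union the values of `h` on `Z` near regular points, where `h = G_z ∘ f` is
  locally constant on `Z` (`exists_levelChart`), a countable set by second countability — so the interval is null, a point.
* `eq_of_preconnected_levelSubset` (appended, ARM A g4): the same WITHOUT unimodality for any preconnected `Z ⊆ {f = c} ∩ S`
  — the toolkit's (An1) `stub_const_on_preconnected_levelSubset` in general form (the piece that survives on multi-hill spheres).

WHAT THIS IS NOT: no NS statement; `PoloidalLiouville` (1222), W1, the line's rung and NF-1a itself stay OPEN here.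
`--supports stmt-NavierStokesRegularity-1222 --as helper`.  [folklore]
-/

noncomputable section

-- the summit and its single sub-problem share the name (CONVENTIONS §1)
set_option linter.dupNamespace false

open Set Function Filter Topology InnerProductSpace MeasureTheory Metric
open scoped RealInnerProductSpace ContDiff

namespace Summit.NavierStokesRegularity.NavierStokesRegularity.Theorems.PoloidalLiouville.NetFlux

open Literature.Analysis Literature.Analysis.FluidPDE Literature.Topology.Euclidean

/-! ### The last-crossing lemma -/

/-- **Last-crossing lemma.**  Let `Q` be continuous on `[a,b]` (`a ≤ b`), locally non-increasing to the right at every point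
of `[a,b)` outside `C` (`∃ δ > 0, ∀ y ∈ (x, x+δ), Q y ≤ Q x`), and let `Q(C ∩ [a,b])` be Lebesgue-null.  Then `Q b ≤ Q a`.
[folklore] -/
theorem lastCrossing_le (Q : ℝ → ℝ) {a b : ℝ} (hab : a ≤ b) (C : Set ℝ) (hQ : ContinuousOn Q (Icc a b))
    (hdec : ∀ x ∈ Ico a b, x ∉ C → ∃ δ > 0, ∀ y ∈ Ioo x (x + δ), Q y ≤ Q x)
    (hnull : volume (Q '' (C ∩ Icc a b)) = 0) : Q b ≤ Q a := by
  by_contra hlt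
  push Not at hlt
  -- a value `y ∈ (Q a, Q b)` which is not a `Q`-value of `C ∩ [a,b]`
  obtain ⟨y, ⟨hya, hyb⟩, hyC⟩ : ∃ y ∈ Ioo (Q a) (Q b), y ∉ Q '' (C ∩ Icc a b) := by
    by_contra hcon
    push Not at hcon
    have hle : volume (Ioo (Q a) (Q b)) ≤ volume (Q '' (C ∩ Icc a b)) := measure_mono fun y hy => hcon y hy
    rw [hnull, Real.volume_Ioo, nonpos_iff_eq_zero, ENNReal.ofReal_eq_zero] at hle
    linarith
  -- the last point of `{Q ≤ y}`
  set A : Set ℝ := Icc a b ∩ {x | Q x ≤ y} with hA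
  have hAc : IsClosed A := hQ.preimage_isClosed_of_isClosed isClosed_Icc isClosed_Iic
  have haA : a ∈ A := ⟨left_mem_Icc.2 hab, hya.le⟩
  have hAbdd : BddAbove A := ⟨b, fun x hx => hx.1.2⟩
  set s := sSup A with hs
  have hsA : s ∈ A := hAc.csSup_mem ⟨a, haA⟩ hAbdd
  have hsb : s < b := by
    rcases hsA.1.2.eq_or_lt with h | h
    · exact absurd hsA.2 (by rw [h]; exact not_le.2 hyb)
    · exact h
  have habove : ∀ x ∈ Ioc s b, y < Q x := by
    intro x hx
    by_contra h
    push Not at h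
    have hxA : x ∈ A := ⟨⟨hsA.1.1.trans hx.1.le, hx.2⟩, h⟩
    exact absurd (le_csSup hAbdd hxA) (not_le.2 hx.1)
  -- continuity from the right at `s` gives `Q s = y`
  have hQs : Q s = y := by
    refine le_antisymm hsA.2 ?_
    have hIoo : Ioo s b ∈ 𝓝[>] s := Ioo_mem_nhdsGT hsb
    have hmem : Icc a b ∈ 𝓝[>] s := mem_of_superset hIoo fun x hx => ⟨hsA.1.1.trans hx.1.le, hx.2.le⟩
    have htend : Tendsto Q (𝓝[>] s) (𝓝 (Q s)) := (hQ s hsA.1).tendsto.mono_left (nhdsWithin_le_of_mem hmem)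
    exact ge_of_tendsto htend (mem_of_superset hIoo fun x hx => (habove x ⟨hx.1, hx.2.le⟩).le)
  -- `s ∉ C`, so `Q` is non-increasing just right of `s`: contradiction
  have hsC : s ∉ C := fun h => hyC ⟨s, ⟨h, hsA.1⟩, hQs⟩
  obtain ⟨δ, hδ, hδQ⟩ := hdec s ⟨hsA.1.1, hsb⟩ hsC
  set x := min (s + δ / 2) b with hx
  have hx1 : s < x := lt_min (by linarith) hsb
  have hx2 : x < s + δ := lt_of_le_of_lt (min_le_left _ _) (by linarith)
  have h1 := hδQ x ⟨hx1, hx2⟩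
  have h2 := habove x ⟨hx1, min_le_right _ _⟩
  rw [hQs] at h1
  linarith

/-! ### Level constancy -/

section Level

variable {f h ν : E3 → ℝ} {x₀ : E3} {r : ℝ}

/-- **Level constancy on a saddle-free sphere.**  `r > 0`; `f, ν` smooth and `h ∈ C¹` on `ℝ³ ∖ {x₀}`; `∇h − ν∇f ∥ (x − x₀)`
on `S_r(x₀)` (the tangential gradient of `h` is `ν∇f`); every strict super- and sub-level set of `f|_S` connected
(`IsUnimodalSphere`).  Then `h` is constant on every level set of `f|_S`. [folklore] -/
theorem eq_of_level (hr : 0 < r) (hf : ContDiffOn ℝ (⊤ : ℕ∞) f ({x₀}ᶜ : Set E3))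
    (hν : ContDiffOn ℝ (⊤ : ℕ∞) ν ({x₀}ᶜ : Set E3)) (hh : ContDiffOn ℝ 1 h ({x₀}ᶜ : Set E3))
    (hpar : ∀ x ∈ Metric.sphere x₀ r, cross (gradient h x - ν x • gradient f x) (x - x₀) = 0)
    (hU : IsUnimodalSphere f x₀ r) {x y : E3} (hx : x ∈ Metric.sphere x₀ r) (hy : y ∈ Metric.sphere x₀ r)
    (hfxy : f x = f y) : h x = h y := by
  classical
  -- it suffices to prove `h x ≤ h y` for all such pairs
  suffices key : ∀ x y : E3, x ∈ Metric.sphere x₀ r → y ∈ Metric.sphere x₀ r → f x = f y → h x ≤ h y from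
    le_antisymm (key x y hx hy hfxy) (key y x hy hx hfxy.symm)
  intro x y hx hy hfxy
  by_contra hlt
  push Not at hlt
  have hsub : Metric.sphere x₀ r ⊆ ({x₀}ᶜ : Set E3) := fun z hz h0 => by
    rw [mem_singleton_iff] at h0
    have := mem_sphere_iff_norm.1 hz
    rw [h0, sub_self, norm_zero] at this
    exact hr.ne' this.symm
  have hfS : ContinuousOn f (Metric.sphere x₀ r) := hf.continuousOn.mono hsub
  have hhS : ContinuousOn h (Metric.sphere x₀ r) := hh.continuousOn.mono hsub
  have hf1 : ContDiffOn ℝ 1 f ({x₀}ᶜ : Set E3) := hf.of_le (by exact_mod_cast le_top)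
  -- the level set through `y`, connected by unicoherence
  set Z : Set E3 := {z : E3 | ‖z - x₀‖ = r ∧ f z = f y} with hZ
  have hZS : Z ⊆ Metric.sphere x₀ r := fun z hz => mem_sphere_iff_norm.2 hz.1
  have hZc : IsPreconnected Z :=
    SphereUnicoherence.isPreconnected_levelSet f x₀ hr hfS (fun c => (hU c).1) (fun c => (hU c).2) (f y)
  have hxZ : x ∈ Z := ⟨mem_sphere_iff_norm.1 hx, hfxy⟩
  have hyZ : y ∈ Z := ⟨mem_sphere_iff_norm.1 hy, rfl⟩
  -- `h(Z)` contains the interval `[h y, h x]`, of positive measure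
  have hint : Icc (h y) (h x) ⊆ h '' Z :=
    (hZc.image h (hhS.mono hZS)).Icc_subset (mem_image_of_mem h hyZ) (mem_image_of_mem h hxZ)
  have hpos : ENNReal.ofReal (h x - h y) ≤ volume (h '' Z) := by
    rw [← Real.volume_Icc]; exact measure_mono hint
  -- split `Z` into critical and regular points of `f|_S`
  set Crit : Set E3 := {z : E3 | z ∈ Metric.sphere x₀ r ∧ cross (gradient f z) (z - x₀) = 0} with hCrit
  have hnullCrit : volume (h '' Crit) = 0 := volume_image_sphCrit_of_parallel_eq_zero f h ν x₀ hr hf hν hh hpar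
  -- charts at the regular points
  have hchart : ∀ z : E3, z ∈ Metric.sphere x₀ r ∧ cross (gradient f z) (z - x₀) ≠ 0 →
      ∃ W : Set E3, IsOpen W ∧ z ∈ W ∧ ∃ ε > (0 : ℝ), ∃ G : ℝ → ℝ,
        (∀ x ∈ W, x ∈ Metric.sphere x₀ r → f x ∈ Ioo (f z - ε) (f z + ε) ∧ h x = G (f x)) ∧
        (∀ c ∈ Ioo (f z - ε) (f z + ε), ∃ x ∈ W, x ∈ Metric.sphere x₀ r ∧ f x = c ∧ HasDerivAt G (ν x) c) :=
    fun z hz => exists_levelChart hr hf1 hh hpar hz.1 hz.2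
  choose! W hWo hzW ε hε G hG hG' using hchart
  set U : E3 → Set E3 := fun z => if z ∈ Metric.sphere x₀ r ∧ cross (gradient f z) (z - x₀) ≠ 0 then W z else ∅
    with hUdef
  have hUo : ∀ z, IsOpen (U z) := fun z => by
    simp only [hUdef]
    split_ifs with hz
    · exact hWo z hz
    · exact isOpen_empty
  obtain ⟨T, hTc, hTU⟩ := TopologicalSpace.isOpen_iUnion_countable U hUo
  -- the regular values of `h` on `Z` form a countable set
  have hreg : h '' (Z \ Crit) ⊆ (fun z => G z (f y)) '' T := by
    rintro _ ⟨w, ⟨hwZ, hwC⟩, rfl⟩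
    have hwS : w ∈ Metric.sphere x₀ r := hZS hwZ
    have hwreg : w ∈ Metric.sphere x₀ r ∧ cross (gradient f w) (w - x₀) ≠ 0 := ⟨hwS, fun h0 => hwC ⟨hwS, h0⟩⟩
    have hwU : w ∈ ⋃ z, U z := mem_iUnion.2 ⟨w, by simp only [hUdef, if_pos hwreg]; exact hzW w hwreg⟩
    rw [← hTU] at hwU
    obtain ⟨z, hzT, hwz⟩ := mem_iUnion₂.1 hwU
    have hzreg : z ∈ Metric.sphere x₀ r ∧ cross (gradient f z) (z - x₀) ≠ 0 := by
      by_contra hz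
      simp only [hUdef, if_neg hz] at hwz
      exact hwz
    simp only [hUdef, if_pos hzreg] at hwz
    refine ⟨z, hzT, ?_⟩
    rw [((hG z hzreg) w hwz hwS).2, hwZ.2]
  have hnullReg : volume (h '' (Z \ Crit)) = 0 :=
    measure_mono_null hreg ((hTc.image _).measure_zero volume)
  -- hence `h(Z)` is null: contradiction
  have hZsplit : h '' Z ⊆ h '' Crit ∪ h '' (Z \ Crit) := by
    rintro _ ⟨w, hwZ, rfl⟩
    by_cases hwC : w ∈ Crit
    · exact Or.inl (mem_image_of_mem h hwC)
    · exact Or.inr (mem_image_of_mem h ⟨hwZ, hwC⟩)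
  have hnull : volume (h '' Z) = 0 :=
    measure_mono_null hZsplit (measure_union_null hnullCrit hnullReg)
  rw [hnull, nonpos_iff_eq_zero, ENNReal.ofReal_eq_zero] at hpos
  linarith

/-- **(An1) in the toolkit's general form — constancy on every CONNECTED SUBSET of a level set, no unimodality.**  `r > 0`;
`f, ν` smooth and `h ∈ C¹` on `ℝ³ ∖ {x₀}`; `∇h − ν∇f ∥ (x − x₀)` on `S_r(x₀)`; `Z ⊆ {x ∈ S_r(x₀) : f x = c}` preconnected.  Then `h`
is constant on `Z`: `h(Z)` is an interval contained in `h(Crit f|_S)` (null, Sard on the sphere) union the countably many local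
values at regular points (`exists_levelChart`), hence a point.  This is `NF1a.stub_const_on_preconnected_levelSubset` of
`netflux_typei_gap_nf1a_toolkit.lean` with `μ` renamed `ν` (the hypothesis form of the other lemmas of this file); it is the piece
that survives on MULTI-HILL spheres (level sets disconnected), e.g. for the «height-head» continuation across saddles. [folklore] -/
theorem eq_of_preconnected_levelSubset (hr : 0 < r) (hf : ContDiffOn ℝ (⊤ : ℕ∞) f ({x₀}ᶜ : Set E3))
    (hν : ContDiffOn ℝ (⊤ : ℕ∞) ν ({x₀}ᶜ : Set E3)) (hh : ContDiffOn ℝ 1 h ({x₀}ᶜ : Set E3))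
    (hpar : ∀ x ∈ Metric.sphere x₀ r, cross (gradient h x - ν x • gradient f x) (x - x₀) = 0)
    {c : ℝ} {Z : Set E3} (hZ : Z ⊆ {x : E3 | ‖x - x₀‖ = r ∧ f x = c}) (hZc : IsPreconnected Z) :
    ∀ x ∈ Z, ∀ y ∈ Z, h x = h y := by
  classical
  -- it suffices to prove `h x ≤ h y` for all pairs in `Z`
  suffices key : ∀ x ∈ Z, ∀ y ∈ Z, h x ≤ h y from
    fun x hx y hy => le_antisymm (key x hx y hy) (key y hy x hx)
  intro x hxZ y hyZ
  by_contra hlt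
  push Not at hlt
  have hsub : Metric.sphere x₀ r ⊆ ({x₀}ᶜ : Set E3) := fun z hz h0 => by
    rw [mem_singleton_iff] at h0
    have := mem_sphere_iff_norm.1 hz
    rw [h0, sub_self, norm_zero] at this
    exact hr.ne' this.symm
  have hZS : Z ⊆ Metric.sphere x₀ r := fun z hz => mem_sphere_iff_norm.2 (hZ hz).1
  have hhZ : ContinuousOn h Z := hh.continuousOn.mono (hZS.trans hsub)
  have hf1 : ContDiffOn ℝ 1 f ({x₀}ᶜ : Set E3) := hf.of_le (by exact_mod_cast le_top)
  -- `h(Z)` contains the interval `[h y, h x]`, of positive measure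
  have hint : Icc (h y) (h x) ⊆ h '' Z :=
    (hZc.image h hhZ).Icc_subset (mem_image_of_mem h hyZ) (mem_image_of_mem h hxZ)
  have hpos : ENNReal.ofReal (h x - h y) ≤ volume (h '' Z) := by
    rw [← Real.volume_Icc]; exact measure_mono hint
  -- critical points of `f|_S` and their `h`-values (null)
  set Crit : Set E3 := {z : E3 | z ∈ Metric.sphere x₀ r ∧ cross (gradient f z) (z - x₀) = 0} with hCrit
  have hnullCrit : volume (h '' Crit) = 0 := volume_image_sphCrit_of_parallel_eq_zero f h ν x₀ hr hf hν hh hpar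
  -- charts at the regular points
  have hchart : ∀ z : E3, z ∈ Metric.sphere x₀ r ∧ cross (gradient f z) (z - x₀) ≠ 0 →
      ∃ W : Set E3, IsOpen W ∧ z ∈ W ∧ ∃ ε > (0 : ℝ), ∃ G : ℝ → ℝ,
        (∀ x ∈ W, x ∈ Metric.sphere x₀ r → f x ∈ Ioo (f z - ε) (f z + ε) ∧ h x = G (f x)) ∧
        (∀ c ∈ Ioo (f z - ε) (f z + ε), ∃ x ∈ W, x ∈ Metric.sphere x₀ r ∧ f x = c ∧ HasDerivAt G (ν x) c) :=
    fun z hz => exists_levelChart hr hf1 hh hpar hz.1 hz.2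
  choose! W hWo hzW ε hε G hG hG' using hchart
  set U : E3 → Set E3 := fun z => if z ∈ Metric.sphere x₀ r ∧ cross (gradient f z) (z - x₀) ≠ 0 then W z else ∅
    with hUdef
  have hUo : ∀ z, IsOpen (U z) := fun z => by
    simp only [hUdef]
    split_ifs with hz
    · exact hWo z hz
    · exact isOpen_empty
  obtain ⟨T, hTc, hTU⟩ := TopologicalSpace.isOpen_iUnion_countable U hUo
  have hreg : h '' (Z \ Crit) ⊆ (fun z => G z c) '' T := by
    rintro _ ⟨w, ⟨hwZ, hwC⟩, rfl⟩
    have hwS : w ∈ Metric.sphere x₀ r := hZS hwZ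
    have hwreg : w ∈ Metric.sphere x₀ r ∧ cross (gradient f w) (w - x₀) ≠ 0 := ⟨hwS, fun h0 => hwC ⟨hwS, h0⟩⟩
    have hwU : w ∈ ⋃ z, U z := mem_iUnion.2 ⟨w, by simp only [hUdef, if_pos hwreg]; exact hzW w hwreg⟩
    rw [← hTU] at hwU
    obtain ⟨z, hzT, hwz⟩ := mem_iUnion₂.1 hwU
    have hzreg : z ∈ Metric.sphere x₀ r ∧ cross (gradient f z) (z - x₀) ≠ 0 := by
      by_contra hz
      simp only [hUdef, if_neg hz] at hwz
      exact hwz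
    simp only [hUdef, if_pos hzreg] at hwz
    refine ⟨z, hzT, ?_⟩
    rw [((hG z hzreg) w hwz hwS).2, (hZ hwZ).2]
  have hnullReg : volume (h '' (Z \ Crit)) = 0 :=
    measure_mono_null hreg ((hTc.image _).measure_zero volume)
  have hZsplit : h '' Z ⊆ h '' Crit ∪ h '' (Z \ Crit) := by
    rintro _ ⟨w, hwZ, rfl⟩
    by_cases hwC : w ∈ Crit
    · exact Or.inl (mem_image_of_mem h hwC)
    · exact Or.inr (mem_image_of_mem h ⟨hwZ, hwC⟩)
  have hnull : volume (h '' Z) = 0 :=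
    measure_mono_null hZsplit (measure_union_null hnullCrit hnullReg)
  rw [hnull, nonpos_iff_eq_zero, ENNReal.ofReal_eq_zero] at hpos
  linarith

end Level

end Summit.NavierStokesRegularity.NavierStokesRegularity.Theorems.PoloidalLiouville.NetFlux

end
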